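import Literature.NumberTheory.EllipticCurves.DescendedFrobeniusMatrix
import Literature.NumberTheory.EllipticCurves.FormalLogExpBaseChangeProofs
import Literature.NumberTheory.EllipticCurves.FormalGroupDictionaryProofs
import Mathlib.RingTheory.IntegralClosure.IntegralRestrict
import HarnessLib

/-!
# Route `CyclotomicUntwist`: GALOIS DESCENT for the descended Frobenius data — `Gal(ℚ₃(ζ₉)/ℚ₃)` permutes the
# good models over `𝓞_{ℚ₃(ζ₉)}` and acts on their Néron classes coefficientwise; a model-independent `ω`-column
# `φ[ω] ≡ c[ω] + d[η]` therefore has `c, d ∈ ℚ₃`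

Cell `pub/bsd-wall` (D-0145 line `route-BirchSwinnertonDyer-CyclotomicUntwist`), prover seat `bsd-line-cycu-p2`
(gen 6), lane «D5»; helper for the LAST non-print step of the lead's reduction
`NineDescendedFrobeniusOfOmegaColumn.isDescendedFrobeniusMatrix_exists_of_omegaColumnTransfer` (which asks for
RATIONAL `c, d`). THEOREMS ONLY (no definition, no named fact, no instance, no `sorry`); helper `--supports` K1 =
stmt-BirchSwinnertonDyer-21580. BSD is not proved by this file and no crux is.

* `map_formalEtaIntegral`: `∫(xω − dz/z²)` commutes with base change of `ℚ`-algebras.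
* `hasBoundedDenominators_map`: `σ ∈ Gal(L/ℚ₃)` preserves bounded denominators (`σ` preserves `𝓞`).
* **`exists_galoisConj`**: for `σ ∈ Gal(L/ℚ₃)` and a good model `𝓜` of `W/ℚ` there is a good model `𝓜^σ`
  (equation `E^σ` via `galRestrict`, change of variables `C^σ`) with `classOmega 𝓜^σ = σ·classOmega 𝓜`,
  `classEta 𝓜^σ = σ·classEta 𝓜` (coefficientwise).
* **`omegaColumn_rational`**: if ONE pair `(c, d) ∈ L²` gives `φ[ω] ≡ c[ω] + d[η]` (`φ = (z ↦ z³)^*`, modulo bounded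
  denominators) on EVERY good model of `W`, and the classes of some good model are independent, then `c, d ∈ ℚ₃`
  (apply `σ`, compare on `𝓜₀ = (𝓜₀^{σ⁻¹})^σ`, uniqueness of coordinates, `L^{Gal} = ℚ₃`).
[cite: Katz1981CrystallineDieudonne, §5 Thm 5.1.5 (functoriality)] [cite: BerthelotOgus1983, Prop. (3.14)]
-/

set_option autoImplicit false
-- single-conjunct summit: `Summit.BirchSwinnertonDyer.BirchSwinnertonDyer.…` repeats the name by design
set_option linter.dupNamespace false

noncomputable section

open PowerSeries Literature.NumberTheory.EllipticCurves Literature.NumberTheory.EllipticCurves.DescendedFrobenius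

namespace Summit.BirchSwinnertonDyer.BirchSwinnertonDyer.Theorems.DescendedFrobeniusGaloisDescent

/-! ## §1 Base change of the `η`-representative -/

/-- **`∫(xω − dz/z²)` commutes with base change of `ℚ`-algebras** (its coefficients are `P_{n+2}/(n+1)` with
`P = z²x·ω/dz ∈ ℤ[aᵢ]⟦z⟧`). [cite: Katz1981CrystallineDieudonne, §5 Lemma 5.1.2] -/
theorem map_formalEtaIntegral {A B : Type*} [CommRing A] [CommRing B] [Algebra ℚ A] [Algebra ℚ B]
    (φ : A →+* B) (W : WeierstrassCurve A) :
    PowerSeries.map φ W.formalEtaIntegral = (W.map φ).formalEtaIntegral := by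
  ext n
  rcases n with _ | n
  · simp only [PowerSeries.coeff_map, PowerSeries.coeff_zero_eq_constantCoeff,
      WeierstrassCurve.constantCoeff_formalEtaIntegral, map_zero]
  · rw [PowerSeries.coeff_map, WeierstrassCurve.coeff_succ_formalEtaIntegral, WeierstrassCurve.coeff_succ_formalEtaIntegral,
      ← W.map_formalXMulSq φ, ← WeierstrassCurve.map_formalOmega' φ W, ← map_mul, PowerSeries.coeff_map,
      ← Algebra.smul_def, ← Algebra.smul_def, map_rat_smul]

/-! ## §2 The Galois group of `L = ℚ₃(ζ₉)` acting on `L⟦z⟧` -/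

/-- `L/ℚ₃` is algebraic (finite cyclotomic). [folklore] -/
theorem isAlgebraic_KNine : Algebra.IsAlgebraic ℚ_[3] KNine :=
  haveI : FiniteDimensional ℚ_[3] KNine := IsCyclotomicExtension.finiteDimensional {9} ℚ_[3] KNine
  inferInstance

/-- `σ ∈ Gal(L/ℚ₃)` preserves `ℤ₃`-integrality. [folklore] -/
theorem isIntegral_galois (σ : KNine ≃ₐ[ℚ_[3]] KNine) {x : KNine} (hx : IsIntegral ℤ_[3] x) :
    IsIntegral ℤ_[3] (σ x) :=
  hx.map (σ.toAlgHom.restrictScalars ℤ_[3])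

/-- **Bounded denominators are Galois-stable.** [folklore] -/
theorem hasBoundedDenominators_map (σ : KNine ≃ₐ[ℚ_[3]] KNine) {f : KNine⟦X⟧} (hf : HasBoundedDenominators f) :
    HasBoundedDenominators (PowerSeries.map (σ : KNine →+* KNine) f) := by
  obtain ⟨d, hd⟩ := hf
  refine ⟨d, fun n ↦ ?_⟩
  have h := isIntegral_galois σ (hd n)
  rw [map_mul, map_pow, show σ (3 : KNine) = 3 from map_ofNat σ 3] at h
  rw [PowerSeries.coeff_map, RingHom.coe_coe]
  exact h

/-- `σ(C c · f) = C(σ c) · σ f`. [folklore] -/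
theorem map_C_mul (σ : KNine →+* KNine) (c : KNine) (f : KNine⟦X⟧) :
    PowerSeries.map σ (PowerSeries.C c * f) = PowerSeries.C (σ c) * PowerSeries.map σ f := by
  rw [map_mul, PowerSeries.map_C]

/-- `σ(c • f) = σ c • σ f`. [folklore] -/
theorem map_smul_eq (σ : KNine →+* KNine) (c : KNine) (f : KNine⟦X⟧) :
    PowerSeries.map σ (c • f) = σ c • PowerSeries.map σ f := by
  rw [PowerSeries.smul_eq_C_mul, map_C_mul, ← PowerSeries.smul_eq_C_mul]

/-! ## §3 Conjugating a good model -/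

/-- **The Galois conjugate of a good model.** For `σ ∈ Gal(L/ℚ₃)` and a good model `𝓜 = (E, C)` of `W/ℚ` over `𝓞`
there is a good model (`E^σ` — `σ` restricted to `𝓞` by `galRestrict` — and `C^σ`; it is a model of `W` because `W`
is defined over `ℚ`) whose Néron classes are the coefficientwise conjugates:
`classOmega 𝓜^σ = σ·classOmega 𝓜`, `classEta 𝓜^σ = σ·classEta 𝓜`. [cite: BerthelotOgus1983, Prop. (3.14)] -/
theorem exists_galoisConj (σ : KNine ≃ₐ[ℚ_[3]] KNine) {W : WeierstrassCurve ℚ} (𝓜 : W.NineGoodModel) :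
    ∃ 𝓜' : W.NineGoodModel, 𝓜'.classOmega = PowerSeries.map (σ : KNine →+* KNine) 𝓜.classOmega ∧
      𝓜'.classEta = PowerSeries.map (σ : KNine →+* KNine) 𝓜.classEta := by
  haveI := isAlgebraic_KNine
  set τ : ONine ≃ₐ[ℤ_[3]] ONine := galRestrict ℤ_[3] ℚ_[3] KNine ONine σ with hτ
  set ι := algebraMap ONine KNine with hι
  -- `ι ∘ τ = σ ∘ ι`
  have hιτ : ι.comp (τ : ONine →+* ONine) = (σ : KNine →+* KNine).comp ι := by
    ext x
    exact algebraMap_galRestrict_apply (A := ℤ_[3]) (K := ℚ_[3]) (L := KNine) (B := ONine) σ x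
  have hE : (𝓜.E.map (τ : ONine →+* ONine)).map ι = (𝓜.E.map ι).map (σ : KNine →+* KNine) := by
    rw [WeierstrassCurve.map_map, WeierstrassCurve.map_map, hιτ]
  have hW : (W.map (algebraMap ℚ KNine)).map (σ : KNine →+* KNine) = W.map (algebraMap ℚ KNine) := by
    rw [WeierstrassCurve.map_map]
    congr 1
    ext q
    simp
  refine ⟨⟨𝓜.E.map (τ : ONine →+* ONine), 𝓜.C.map (σ : KNine →+* KNine), ?_, ?_⟩, ?_, ?_⟩
  · rw [WeierstrassCurve.map_Δ]; exact 𝓜.isUnit_Δ.map _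
  · rw [hE, ← 𝓜.smul_eq, ← WeierstrassCurve.map_variableChange, hW]
  · -- classOmega
    change (((𝓜.C.map (σ : KNine →+* KNine)).u⁻¹ : KNineˣ) : KNine) •
        ((𝓜.E.map (τ : ONine →+* ONine)).map ι).formalLog = PowerSeries.map (σ : KNine →+* KNine)
          (((𝓜.C.u⁻¹ : KNineˣ) : KNine) • (𝓜.E.map ι).formalLog)
    rw [map_smul_eq, WeierstrassCurve.map_formalLog, hE]
    congr 1
  · -- classEta
    change ((𝓜.C.map (σ : KNine →+* KNine)).u : KNine) • ((𝓜.E.map (τ : ONine →+* ONine)).map ι).formalEtaIntegral +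
        ((𝓜.C.map (σ : KNine →+* KNine)).r * (((𝓜.C.map (σ : KNine →+* KNine)).u⁻¹ : KNineˣ) : KNine)) •
          ((𝓜.E.map (τ : ONine →+* ONine)).map ι).formalLog =
      PowerSeries.map (σ : KNine →+* KNine) ((𝓜.C.u : KNine) • (𝓜.E.map ι).formalEtaIntegral +
        (𝓜.C.r * ((𝓜.C.u⁻¹ : KNineˣ) : KNine)) • (𝓜.E.map ι).formalLog)
    rw [map_add, map_smul_eq, map_smul_eq, WeierstrassCurve.map_formalLog, map_formalEtaIntegral, hE, map_mul]
    congr 2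

/-! ## §4 Descent of the `ω`-column -/

/-- **A model-independent `ω`-column is rational.** If a single pair `(c, d) ∈ L²` satisfies
`φ[ω] ≡ c[ω] + d[η]` (mod bounded denominators; `φ = (z ↦ z³)^*`) on EVERY good model of `W` over `𝓞_L`, and the
classes `[ω], [η]` of some good model `𝓜₀` are independent, then `c, d ∈ ℚ₃`: for `σ ∈ Gal(L/ℚ₃)`, conjugating the
relation on `𝓜₀^{σ⁻¹}` by `σ` gives the relation on `𝓜₀` with `(σc, σd)`, so `σc = c`, `σd = d` by uniqueness of
coordinates, and `L^{Gal(L/ℚ₃)} = ℚ₃`. [cite: BerthelotOgus1983, Prop. (3.14)]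
[cite: Katz1981CrystallineDieudonne, Thm. 5.3.3] -/
theorem omegaColumn_rational {W : WeierstrassCurve ℚ} {c d : KNine}
    (hall : ∀ 𝓜' : W.NineGoodModel, HasBoundedDenominators (expand 3 (by norm_num) 𝓜'.classOmega -
      PowerSeries.C c * 𝓜'.classOmega - PowerSeries.C d * 𝓜'.classEta))
    (𝓜₀ : W.NineGoodModel) (hind : 𝓜₀.ClassesIndependent) :
    c ∈ Set.range (algebraMap ℚ_[3] KNine) ∧ d ∈ Set.range (algebraMap ℚ_[3] KNine) := by
  haveI : IsGalois ℚ_[3] KNine := IsCyclotomicExtension.isGalois {9} ℚ_[3] KNine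
  haveI : FiniteDimensional ℚ_[3] KNine := IsCyclotomicExtension.finiteDimensional {9} ℚ_[3] KNine
  suffices h : ∀ σ : KNine ≃ₐ[ℚ_[3]] KNine, σ c = c ∧ σ d = d from
    ⟨(IsGalois.mem_range_algebraMap_iff_fixed c).mpr fun σ ↦ (h σ).1,
      (IsGalois.mem_range_algebraMap_iff_fixed d).mpr fun σ ↦ (h σ).2⟩
  intro σ
  obtain ⟨𝓜₁, hΩ, hH⟩ := exists_galoisConj σ.symm 𝓜₀
  -- conjugate the relation on `𝓜₁` by `σ`: a relation on `𝓜₀` with `(σ c, σ d)`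
  have hback : ∀ f : KNine⟦X⟧, PowerSeries.map (σ : KNine →+* KNine) (PowerSeries.map (σ.symm : KNine →+* KNine) f) = f := by
    intro f
    rw [← RingHom.comp_apply (PowerSeries.map (σ : KNine →+* KNine)), ← PowerSeries.map_comp]
    have e : (σ : KNine →+* KNine).comp (σ.symm : KNine →+* KNine) = RingHom.id KNine := by
      ext x; simp
    rw [e]
    exact congrFun PowerSeries.map_id f
  have h1 := hasBoundedDenominators_map σ (hall 𝓜₁)
  rw [map_sub, map_sub, PowerSeries.map_expand, map_C_mul, map_C_mul, hΩ, hH, hback, hback] at h1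
  have h0 := hall 𝓜₀
  -- uniqueness of coordinates on `𝓜₀`
  rw [← PowerSeries.smul_eq_C_mul, ← PowerSeries.smul_eq_C_mul] at h0 h1
  obtain ⟨hc, hd⟩ := hind.coeffs_unique h1 h0
  exact ⟨hc, hd⟩

end Summit.BirchSwinnertonDyer.BirchSwinnertonDyer.Theorems.DescendedFrobeniusGaloisDescent
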